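import Mathlib

/-!
# NormContact — the dual form of the six-line lattice `L17` and the norm–contact identity (solo-blind s161)

Setting (HOME `work/s153/cup.md` §2, `work/s161/p2a.md` §5).  `K` is the minimal resolution of the double
plane branched along six lines forming three pairs whose three intersection points `(1,2),(3,4),(5,6)`
("special nodes") are collinear; the line through them splits upstairs as `l⁺ + l⁻`.  The lattice
`L17 = ⟨h, E_P (15 nodes P), l⁺⟩ ⊂ NS(K)` has Gram matrix `gram` below (`h² = 2`, `E_P² = l⁺² = −2`,
`h·l⁺ = 1`, `l⁺·E_P = 1` exactly for the three special nodes, all other products `0`), rank 17,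
`|disc| = 64`.

For a curve class `γ` on `K` write `t = (e; m_P; λ) ∈ ℤ¹⁷` for its vector of intersection numbers with
the generators and `v` for the orthogonal projection of `γ` to `L17 ⊗ ℚ`; then `v² = tᵀ·gram⁻¹·t`.
NORM–CONTACT identity (p2a.md §5):

  `v² = (e² − Σ_P m_P²)/2 − κ²/4`,   `κ := 2λ − e + m₁₂ + m₃₄ + m₅₆`,

equivalently `gram⁻¹ = S/4` with the INTEGER matrix `S = 2·diag(1, −1,…,−1, 0) − k·kᵀ`,
`k = (−1; 1 at the special nodes, 0 at the others; 2)`.  This file certifies `S·gram = gram·S = 4·1`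
by a closed kernel computation (`decide` on list matrices; no `native_decide`, no extra axioms), and
records the elementary consequences used in p2a.md §5–§6 as algebraic lemmas over `ℚ`:
with `s = γ²` and `C⁺·C⁻ = e² − Σ m_P² − s` (adjunction on the double cover: `γ + ιγ = e·h − Σ m_P E_P`)
the Picard-jump norm `n = s − v²` equals `(s − C⁺·C⁻)/2 + κ²/4 ≥ (s − C⁺·C⁻)/2`; in particular a
rational split curve (`s = −2`) realising the class-6 Heegner norm `n = −6` (`|disc NS₁₈| = 384`) needs
`C⁺·C⁻ ≥ 10`, while the pentagon conics (`C⁺·C⁻ = 1`, `κ = 0`) give `n = −3/2` (`|disc| = 96`).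

Generator order: index `0 = h`; indices `1..15 = E_P` for `P` in lexicographic pair order
`(1,2),(1,3),(1,4),(1,5),(1,6),(2,3),(2,4),(2,5),(2,6),(3,4),(3,5),(3,6),(4,5),(4,6),(5,6)`
(special nodes at indices `1, 10, 15`); index `16 = l⁺`.
-/

namespace Summit.HodgeConjecture.HodgeConjecture.Theorems.NormContact

/-- A 17×17 integer matrix as a list of rows. -/
abbrev M17 := List (List ℤ)

/-- Entry accessor (out-of-range entries read as 0). -/
def ent (A : M17) (i j : ℕ) : ℤ := (A.getD i []).getD j 0

/-- Product of 17×17 list matrices. -/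
def mul (A B : M17) : M17 :=
  (List.range 17).map fun i => (List.range 17).map fun j =>
    ((List.range 17).map fun l => ent A i l * ent B l j).sum

/-- Scalar matrix `c·1`. -/
def scalar (c : ℤ) : M17 :=
  (List.range 17).map fun i => (List.range 17).map fun j => if i = j then c else 0

/-- Transpose of a 17×17 list matrix. -/
def transpose (A : M17) : M17 :=
  (List.range 17).map fun i => (List.range 17).map fun j => ent A j i

/-- Indices of the three special nodes `(1,2),(3,4),(5,6)` among the generators. -/
def special : List ℕ := [1, 10, 15]

/-- Gram matrix of `L17` in the generators `(h, E_P, l⁺)`. -/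
def gram : M17 :=
  (List.range 17).map fun i => (List.range 17).map fun j =>
    if i = j then (if i = 0 then 2 else -2)
    else if (i = 0 ∧ j = 16) ∨ (i = 16 ∧ j = 0) then 1
    else if (i = 16 ∧ j ∈ special) ∨ (j = 16 ∧ i ∈ special) then 1
    else 0

/-- Coefficient vector of `κ(t) = −e + m₁₂ + m₃₄ + m₅₆ + 2λ`. -/
def kappaCoeff (i : ℕ) : ℤ :=
  if i = 0 then -1 else if i = 16 then 2 else if i ∈ special then 1 else 0

/-- Diagonal of `2·D`, `D = diag(1, −1 (×15), 0)`: the matrix of `2e² − 2Σ m_P²`. -/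
def twoD (i : ℕ) : ℤ := if i = 0 then 2 else if i = 16 then 0 else -2

/-- `S = 2D − k kᵀ`: the matrix of the integral quadratic form `4·v²(t) = 2e² − 2Σ_P m_P² − κ(t)²`. -/
def dualForm4 : M17 :=
  (List.range 17).map fun i => (List.range 17).map fun j =>
    (if i = j then twoD i else 0) - kappaCoeff i * kappaCoeff j

/-- `gram` is symmetric. -/
theorem gram_symm : transpose gram = gram := by decide

/-- `S` is symmetric. -/
theorem dualForm4_symm : transpose dualForm4 = dualForm4 := by decide

/-- MAIN CERTIFICATE: `S · gram = 4·1`.  Hence `gram⁻¹ = S/4`, i.e. for every `t ∈ ℤ¹⁷`,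
`v²(t) = ¼ tᵀ S t = (e² − Σ_P m_P²)/2 − κ(t)²/4` (NORM–CONTACT, lattice half). -/
theorem dualForm4_mul_gram : mul dualForm4 gram = scalar 4 := by decide

/-- The same on the other side: `gram · S = 4·1`. -/
theorem gram_mul_dualForm4 : mul gram dualForm4 = scalar 4 := by decide

/-- A sample row of `S`: the `h`-row is `(1, 1 at special / 0 else, …, 2)` — i.e.
`4v²` contains `e²·(2 − 1)`, cross terms `2e·m_P` for special `P` and `4eλ`. -/
theorem dualForm4_row0 :
    (dualForm4.getD 0 []) = [1, 1, 0, 0, 0, 0, 0, 0, 0, 0, 1, 0, 0, 0, 0, 1, 2] := by decide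

/-- NORM–CONTACT, algebraic half: if `v² = (e² − Σm²)/2 − κ²/4`, `n = s − v²` and
`C⁺·C⁻ = e² − Σm² − s`, then `n = (s − C⁺·C⁻)/2 + κ²/4`. -/
theorem norm_contact (s e2 sumsq κ v2 n cc : ℚ)
    (hv : v2 = (e2 - sumsq) / 2 - κ ^ 2 / 4) (hn : n = s - v2) (hcc : cc = e2 - sumsq - s) :
    n = (s - cc) / 2 + κ ^ 2 / 4 := by
  subst hv; subst hn; subst hcc; ring

/-- The norm bound `n ≥ (s − C⁺·C⁻)/2`, i.e. `|disc NS₁₈| = 64|n| ≤ 32·(C⁺·C⁻ − s)`. -/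
theorem norm_contact_bound (s cc κ : ℚ) : (s - cc) / 2 ≤ (s - cc) / 2 + κ ^ 2 / 4 := by
  nlinarith [sq_nonneg κ]

/-- For rational split curves (`s = −2`) the class-6 norm `n = −6` (`|disc| 384`) forces `C⁺·C⁻ ≥ 10`:
at least ten units of tangency / separated-free-node contact. -/
theorem class6_second_needs_ten (cc κ : ℚ) (h : (-6 : ℚ) = (-2 - cc) / 2 + κ ^ 2 / 4) : 10 ≤ cc := by
  nlinarith [sq_nonneg κ]

/-- More generally `n = −(3/2)·k²` with `s = −2` forces `C⁺·C⁻ ≥ 3k² − 2`. -/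
theorem class6_series_contact (k cc κ : ℚ) (h : -(3 / 2 : ℚ) * k ^ 2 = (-2 - cc) / 2 + κ ^ 2 / 4) :
    3 * k ^ 2 - 2 ≤ cc := by
  nlinarith [sq_nonneg κ]

/-- Pentagon conics: `s = −2`, `C⁺·C⁻ = T = 1`, `κ = 0` give `n = −3/2` (`|disc| = 64·3/2 = 96`). -/
theorem pentagon_norm : ((-2 : ℚ) - 1) / 2 + (0 : ℚ) ^ 2 / 4 = -3 / 2 ∧ (64 : ℚ) * (3 / 2) = 96 := by
  norm_num

/-- Node-triple lines / hexagon conics: `s = −2`, `C⁺·C⁻ = 0`, `κ = ±1` give `n = −3/4` (`|disc| 48`);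
with a special node (`κ = 0`) `n = −1` (`|disc| 64`); the cubic `P j=4` orbit with `κ = ±2` has `n = 0`
(no Picard jump: the condition is identically satisfied). -/
theorem line_norms :
    ((-2 : ℚ) - 0) / 2 + (1 : ℚ) ^ 2 / 4 = -3 / 4 ∧ ((-2 : ℚ) - 0) / 2 + (0 : ℚ) ^ 2 / 4 = -1 ∧
    ((-2 : ℚ) - 0) / 2 + (2 : ℚ) ^ 2 / 4 = 0 := by
  norm_num

end Summit.HodgeConjecture.HodgeConjecture.Theorems.NormContact
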